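import Summits.AtomisticToContinuum.Crystallization.Theorems.FrustratedLawDichotomyStrainedPatchHomSlopeLJAffine2Pieces

/-!
# K1-v2 kernel, COMPONENT-CERTIFIED form: the quadratic term entered through PAYLOAD component bounds `Q i ≥ quadVec2F i` (each a separate kernel fact, ≈ 90 s)
# (27623 `(H) HomFloor (1/625)`, hcp half; hand-1 g34 FINDING §3b)

decomp-a2c hand-1 g34 (crux `AperiodicFrustratedLawGap`, stmt-AtomisticToContinuum-27623).  Kernel measurement (seat probe X1): ONE component of the quadratic piece
(`quadVec…  0`, tabulated records) certifies in 88 s, while the three components under one square root exceed the kernel's memory.  Since `natSqrtCeil` is not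
monotone by construction, the square root cannot be bounded from component bounds after the fact; instead the CHECK itself takes payload component bounds:
★ `slopeCheckLJA2Q c w J Lc Ln Q Gs := guards ∧ (∀ i, quadVec2F i ≤ Q i) ∧ g0 + lin + ⌈√(ΣQ²)⌉ + rem3 + nai ≤ Gs` — soundness is `…Affine2F` verbatim with the
component bounds `Q i` in place of `quadVec2F i` inside `abs_sum_mul_le_sqrtHi` (`…Affine2Q.slopeLJA2Q_bound_of_check`).  Kernel side: `quadVec2R` (tabulated, =
`quadVec2F` by ★ `quadVec2R_eq`), so each `quadVec2F i ≤ Q i` is ONE `decide` on the tabulated form.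

Kernel definitions + equalities; 0 sorry; standard axioms; no instances / notation / `#eval`.  `--supports stmt-AtomisticToContinuum-27623`.
-/

noncomputable section

namespace Summit.AtomisticToContinuum.Crystallization.Theorems.FrustratedLawDichotomyStrainedPatchHomEntryLeafHT

open Literature.Analysis.ValidatedNumerics.Numerics
open Summit.AtomisticToContinuum.Crystallization.Theorems.FrustratedLawDichotomyStrainedPatchHomCurvLJ (ljLabelOK naiveLJ)
open Summit.AtomisticToContinuum.Crystallization.Theorems.FrustratedLawDichotomyStrainedPatchHomSlopeLJ
open Summit.AtomisticToContinuum.Crystallization.Theorems.FrustratedLawDichotomyStrainedPatchHomSlopeLJAffine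
open Summit.AtomisticToContinuum.Crystallization.Theorems.FrustratedLawDichotomyStrainedPatchHomSlopeLJAffine2Kit

/-- Square root of the payload component bounds: `⌈√(Q₀² + Q₁² + Q₂²)⌉` (scaled). -/
def sqrtQ (Q : Fin 3 → ℤ) : ℤ := (FI.sqrt ⟨0, cdiv (∑ i : Fin 3, Q i ^ 2) SC⟩).hi

/-- ★ **THE COMPONENT-CERTIFIED SECOND-ORDER AFFINE SLOPE CHECK** (fast array; `Q` = payload bounds of the three quadratic components). -/
def slopeCheckLJA2Q (c w : (Fin 3 × Fin 3) ⊕ Fin 3 → ℤ) (J : Fin 3 → Fin 3 × Fin 3 → ℤ) (Lc Ln : List (Fin 3 → ℤ)) (Q : Fin 3 → ℤ) (Gs : ℤ) : Bool :=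
  (Lc.all fun b => ljLabelOK c (hullW J w) b) && (Ln.all fun b => (naiveLJ c (hullW J w) b).isSome) &&
    (decide (quadVec2F c w J Lc 0 ≤ Q 0) && decide (quadVec2F c w J Lc 1 ≤ Q 1) && decide (quadVec2F c w J Lc 2 ≤ Q 2)) &&
    decide (g0LJ c Lc + linLJA c w J Lc + sqrtQ Q + rem3LJ c (hullW J w) Lc + naiSLJ c (hullW J w) Ln ≤ Gs)

/-- The quadratic component over tabulated records (kernel form of `quadVec2F i`). -/
def quadVec2R (c w : (Fin 3 × Fin 3) ⊕ Fin 3 → ℤ) (J : Fin 3 → Fin 3 × Fin 3 → ℤ) (Lc : List (Fin 3 → ℤ)) (i : Fin 3) : ℤ :=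
  let rs := recsT c w J Lc
  let t0 := memo3 fun k => memo3 fun k' => memo3 fun i => T0R rs k k' i
  let w1 := memo3 fun l => memo3 fun k => memo3 fun k' => memo3 fun i => W1R rs l k k' i
  let w2 := memo3 fun l => memo3 fun l' => memo3 fun k => memo3 fun k' => memo3 fun i => W2R rs l l' k k' i
  cdiv (∑ a : Fin 3 × Fin 3, ∑ a' : Fin 3 × Fin 3, cdiv (w (Sum.inl a) * w (Sum.inl a')) SC * (QarrT c J t0 w1 w2 i a a').absHi + resQR c w J rs i) (2 * SC)

/-- ★ `quadVec2R = quadVec2F`. [formal bookkeeping] -/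
theorem quadVec2R_eq (c w : (Fin 3 × Fin 3) ⊕ Fin 3 → ℤ) (J : Fin 3 → Fin 3 × Fin 3 → ℤ) (Lc : List (Fin 3 → ℤ)) (i : Fin 3) :
    quadVec2R c w J Lc i = quadVec2F c w J Lc i := by
  have ht0 : (memo3 fun k => memo3 fun k' => memo3 fun i => T0R (recsT c w J Lc) k k' i) = tabT0 (recsA2 c w J Lc) := by
    funext k k' i; simp only [memo3_apply, tabT0, T0R_eq]
  have hw1 : (memo3 fun l => memo3 fun k => memo3 fun k' => memo3 fun i => W1R (recsT c w J Lc) l k k' i) = tabW1 (recsA2 c w J Lc) := by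
    funext l k k' i; simp only [memo3_apply, tabW1, W1R_eq]
  have hw2 : (memo3 fun l => memo3 fun l' => memo3 fun k => memo3 fun k' => memo3 fun i => W2R (recsT c w J Lc) l l' k k' i) = tabW2 (recsA2 c w J Lc) := by
    funext l l' k k' i; simp only [memo3_apply, tabW2, W2R_eq]
  have hQ : ∀ a a', QarrT c J (tabT0 (recsA2 c w J Lc)) (tabW1 (recsA2 c w J Lc)) (tabW2 (recsA2 c w J Lc)) i a a' = QarrL c J (recsA2 c w J Lc) i a a' := by
    intro a a'; simp only [QarrT, QarrL, tabT0_apply, tabW1_apply, tabW2_apply]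
  rw [← quadVec2L_eq]
  simp only [quadVec2R, quadVec2L, ht0, hw1, hw2, hQ, resQR_eq]

end Summit.AtomisticToContinuum.Crystallization.Theorems.FrustratedLawDichotomyStrainedPatchHomEntryLeafHT

end
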